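import Literature.NumberTheory.Automorphic.UnitaryGroupBorelSiegelSetStructure
import Literature.NumberTheory.Automorphic.IdeleNormOneSplitting
import HarnessLib

/-!
# The root windows of the torus Siegel set of `U(3)`: from the polar export
# `d₀ = w · z(eˢ)`, `d₁ ∈ W`, `H(t) = e^{[E:ℚ] s} · H(1)` to compact windows for `d₀⁻¹ d₁`, `d₀⁻¹ d₂`
# and the archimedean balance `‖(d₀⁻¹ d₁)_w‖ ≤ κ · H(t)^{-1/[E:ℚ]}`
(Rogawski, *Automorphic Representations of Unitary Groups in Three Variables* (1990), §2.2, p. 13;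
Borel, *Some finiteness properties of adele groups over number fields* (1963), §5: on the Siegel set
`𝔖 = ω A_t K` the roots are bounded below on `A_t` and `a⁻¹ ω a` stays in a compact set)

Topic `NumberTheory/Automorphic`; namespace `Literature.NumberTheory.Automorphic.UnitaryGroup`. THEOREMS
ONLY over accepted tree modules: no definition, no named fact, no `sorry`, no instance, no notation.
This is the hypotheses-first JUNCTION between the torus Siegel set of the cell road (brick H9a: a closed
`S_T ⊆ T(𝔸_F)` whose elements `t = diag(d₀, d₁, d₂)` have the POLAR EXPORT `d₀ = w · z(eˢ)` with `w` in a
compact `W ⊆ 𝕀_E`, `d₁ ∈ W`, `‖d₀‖_𝔸 = e^{[E:ℚ] s}` and `H(t) = ‖d₀‖_𝔸 · H(1)`; `z = posRealIdele E` the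
positive real ray) and its consumers, which read the ROOT VALUES `d₀⁻¹ d₁`, `d₀⁻¹ d₂` (★
`UnitaryGroupBorelLatticeCellCountSiegel` H4-d, ★ `UnitaryGroupBorelSiegelSetStructure` H9b (i), and the
oscillation and ray-integral bricks, which need one archimedean power of the ray):

* §1 `coe_diagUnit_two_eq_conjAdele_inv` — on `T(𝔸_F)`, `d₂ = c(d₀⁻¹)` (★ `torus_relations`);
  `conjAdele_coe_posRealIdele` — `c` fixes the ray (★ `smul_posRealIdele`); `coe_inv_posRealIdele_expUnitNNReal`.
* §2 (private plumbing) `exp_neg_le_of_one_le_height` — if `1 ≤ e^{n s} · H₁` (`H₁ > 0`, `n > 0`) then `e^{-s} ≤ H₁^{1/n}`;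
  `exp_neg_eq_rpow_height` — `e^{-s} = (e^{n s} H₁)^{-1/n} · H₁^{1/n}`.
* §3 **`exists_rootWindows_of_export`** — LETTERS: compact `R₁, R₂ ⊆ 𝔸_E` with `d₀⁻¹ d₁ ∈ R₁`,
  `d₀⁻¹ d₂ ∈ R₂` for every `t ∈ S_T` with `1 ≤ H(t)` (`d₀⁻¹ d₁ = z(e^{-s}) · w⁻¹ d₁`,
  `d₀⁻¹ d₂ = z(e^{-s})² · w⁻¹ c(w⁻¹)`, `e^{-s} ≤ H(1)^{1/[E:ℚ]}`).
* §4 **`exists_balance_of_export`** — BALANCE: `∃ κ, ∀ t ∈ S_T, ∀ w ∣ ∞,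
  ‖(d₀⁻¹ d₁)_w‖ ≤ κ · H(t)^{-1/[E:ℚ]}` (`‖z(r)_w‖ = r`, ★ `nnnorm_posRealIdele_fst_apply`; `w⁻¹ d₁` ranges in
  the compact `W⁻¹ W`).
* §5 `exists_rootWindows_and_balance_of_export` — both, in the letters of the H9a export.

## References

* J. D. Rogawski, *Automorphic Representations of Unitary Groups in Three Variables*, Annals of
  Mathematics Studies 123 (1990), §2.2 (p. 13) [Rogawski1990].
* A. Borel, *Some finiteness properties of adele groups over number fields*, Publ. Math. IHÉS 16
  (1963), §5 [Borel1963].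
-/

set_option autoImplicit false

noncomputable section

open NumberField IsDedekindDomain Topology Set
open scoped NNReal MatrixGroups Pointwise

namespace Literature.NumberTheory.Automorphic

namespace UnitaryGroup

variable {F E : Type} [Field F] [NumberField F] [Field E] [NumberField E] [Algebra F E]
  {c : E ≃ₐ[F] E}

/-! ## §1 Torus bookkeeping: `d₂ = c(d₀⁻¹)`, the ray is `c`-fixed -/

/-- **On `T(𝔸_F)`, `d₂ = c(d₀⁻¹)`** for a torus element `t` (`torusPart t = t`) with diagonal `d = diagUnit t`
(★ `torus_relations`: `c(d₀) d₂ = 1`). [cite: Rogawski1990, §1.10] -/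
theorem coe_diagUnit_two_eq_conjAdele_inv {t : borelAdelic F E c 3} (ht : torusPart t = t) :
    ((diagUnit t.2 2 : (AdeleRing (𝓞 E) E)ˣ) : AdeleRing (𝓞 E) E) =
      conjAdele F E c (((diagUnit t.2 0)⁻¹ : (AdeleRing (𝓞 E) E)ˣ) : AdeleRing (𝓞 E) E) := by
  set tB : torusInBorel F E c 3 := ⟨t, (mem_torusInBorel_iff_torusPart_eq t).2 ht⟩ with htB
  have hd : glDiagonal 3 (AdeleRing (𝓞 E) E) (diagUnit t.2) =
      adelicVal F E c 3 _ (((tB : torusInBorel F E c 3) : borelAdelic F E c 3) : (quasiSplit F E c 3).Adelic) :=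
    (adelicVal_eq_glDiagonal_of_torusPart_eq ht).symm
  obtain ⟨-, -, h02⟩ := torus_relations tB hd
  have h1 : conjAdele F E c (((diagUnit t.2 0)⁻¹ : (AdeleRing (𝓞 E) E)ˣ) : AdeleRing (𝓞 E) E) *
      conjAdele F E c (diagUnit t.2 0 : AdeleRing (𝓞 E) E) = 1 := by
    rw [← map_mul, Units.inv_mul, map_one]
  have h2 : conjAdele F E c (diagUnit t.2 0 : AdeleRing (𝓞 E) E) =
      (((diagUnit t.2 2)⁻¹ : (AdeleRing (𝓞 E) E)ˣ) : AdeleRing (𝓞 E) E) :=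
    (Units.inv_eq_of_mul_eq_one_left h02).symm
  rw [h2] at h1
  calc ((diagUnit t.2 2 : (AdeleRing (𝓞 E) E)ˣ) : AdeleRing (𝓞 E) E)
      = conjAdele F E c (((diagUnit t.2 0)⁻¹ : (AdeleRing (𝓞 E) E)ˣ) : AdeleRing (𝓞 E) E) *
          (((diagUnit t.2 2)⁻¹ : (AdeleRing (𝓞 E) E)ˣ) : AdeleRing (𝓞 E) E) * diagUnit t.2 2 := by
        rw [h1, one_mul]
    _ = conjAdele F E c (((diagUnit t.2 0)⁻¹ : (AdeleRing (𝓞 E) E)ˣ) : AdeleRing (𝓞 E) E) := by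
        rw [mul_assoc, Units.inv_mul, mul_one]

omit [NumberField F] in
/-- **The positive real ray is `c`-fixed**: `c(z(r)) = z(r)` (★ `smul_posRealIdele`). [cite: Borel1963, §5] -/
theorem conjAdele_coe_posRealIdele (r : ℝ≥0ˣ) :
    conjAdele F E c ((posRealIdele E r : (AdeleRing (𝓞 E) E)ˣ) : AdeleRing (𝓞 E) E) =
      ((posRealIdele E r : (AdeleRing (𝓞 E) E)ˣ) : AdeleRing (𝓞 E) E) := by
  rw [conjAdele_apply, ← AdeleRing.coe_smul_units F c (posRealIdele E r), smul_posRealIdele F E c r]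

omit [NumberField F] [Algebra F E] in
/-- `z(eˢ)⁻¹ = z(e^{-s})` as adeles, and `z(e^{-s}) = realAdele E (e^{-s})`. [cite: Borel1963, §5] -/
theorem coe_inv_posRealIdele_expUnitNNReal (s : ℝ) :
    (((posRealIdele E (expUnitNNReal s))⁻¹ : (AdeleRing (𝓞 E) E)ˣ) : AdeleRing (𝓞 E) E) =
      realAdele E (Real.exp (-s)) := by
  have h : (expUnitNNReal s)⁻¹ = expUnitNNReal (-s) := Units.ext (Subtype.ext rfl)
  rw [← map_inv, h, coe_posRealIdele, coe_expUnitNNReal]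

/-! ## §2 Real bookkeeping: `e^{-s}` against the height `e^{n s} · H₁` -/

/-- If `1 ≤ e^{n s} · H₁` with `0 < n`, then `e^{-s} ≤ H₁^{1/n}`. [folklore] -/
private theorem exp_neg_le_of_one_le_height {n s H₁ : ℝ} (hn : 0 < n)
    (h : 1 ≤ Real.exp (n * s) * H₁) : Real.exp (-s) ≤ H₁ ^ (1 / n) := by
  -- `e^{-n s} ≤ H₁`
  have h1 : Real.exp (-(n * s)) ≤ H₁ := by
    rw [Real.exp_neg, inv_le_iff_one_le_mul₀ (Real.exp_pos _)]
    linarith [mul_comm (Real.exp (n * s)) H₁]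
  have h2 : Real.exp (-s) = Real.exp (-(n * s)) ^ (1 / n) := by
    rw [← Real.exp_mul]
    congr 1
    field_simp
  rw [h2]
  exact Real.rpow_le_rpow (Real.exp_pos _).le h1 (by positivity)

/-- `e^{-s} = (e^{n s} · H₁)^{-1/n} · H₁^{1/n}` for `0 < H₁`, `n ≠ 0`. [folklore] -/
private theorem exp_neg_eq_rpow_height {n s H₁ : ℝ} (hn : n ≠ 0) (hH₁ : 0 < H₁) :
    Real.exp (-s) = (Real.exp (n * s) * H₁) ^ (-(1 / n)) * H₁ ^ (1 / n) := by
  rw [Real.mul_rpow (Real.exp_pos _).le hH₁.le, ← Real.exp_mul, mul_assoc, ← Real.rpow_add hH₁,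
    neg_add_cancel, Real.rpow_zero, mul_one]
  congr 1
  field_simp

/-! ## §3 The root windows -/

/-- **THE ROOT WINDOWS OF THE TORUS SIEGEL SET.** Let `S_T ⊆ B(𝔸_F)` consist of torus elements with the
polar export: `d₀ = w · z(eˢ)`, `w ∈ W`, `d₁ ∈ W` (`W ⊆ 𝕀_E` compact), `‖d₀‖_𝔸 = e^{[E:ℚ] s}` and
`H(t) = ‖d₀‖_𝔸 · H(1)`. Then there are compact `R₁, R₂ ⊆ 𝔸_E` with `d₀⁻¹ d₁ ∈ R₁` and `d₀⁻¹ d₂ ∈ R₂` for every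
`t ∈ S_T` of height `≥ 1`: `d₀⁻¹ d₁ = z(e^{-s}) · (w⁻¹ d₁)`, `d₀⁻¹ d₂ = z(e^{-s})² · (w⁻¹ c(w⁻¹))` (§1) with
`e^{-s} ≤ H(1)^{1/[E:ℚ]}` (§2), so `R₁ = z([0, r]) · W⁻¹W`, `R₂ = z([0, r])² · {w⁻¹ c(w⁻¹)}` do — the
LETTERS clause of brick H9a, i.e. the root-value hypotheses of ★ `exists_forall_card_mul_measure_le_mul_torusRootModulus`
and ★ `exists_isCompact_structure_of_mem_siegel`. [cite: Rogawski1990, §2.2 (p. 13)] -/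
theorem exists_rootWindows_of_export {S_T : Set (borelAdelic F E c 3)}
    {W : Set (AdeleRing (𝓞 E) E)ˣ} (hW : IsCompact W) (hSTt : ∀ t ∈ S_T, torusPart t = t)
    (hexp : ∀ t ∈ S_T, ∃ w ∈ W, ∃ s : ℝ,
      diagUnit t.2 0 = w * posRealIdele E (expUnitNNReal s) ∧ diagUnit t.2 1 ∈ W ∧
      IdeleClassGroup.ideleNorm E (diagUnit t.2 0) = ((expUnitNNReal (Module.finrank ℚ E * s) : ℝ≥0ˣ) : ℝ≥0) ∧
      borelHeight (t : (quasiSplit F E c 3).Adelic) =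
        IdeleClassGroup.ideleNorm E (diagUnit t.2 0) * borelHeight (1 : (quasiSplit F E c 3).Adelic)) :
    ∃ R₁ R₂ : Set (AdeleRing (𝓞 E) E), IsCompact R₁ ∧ IsCompact R₂ ∧ ∀ t ∈ S_T,
      1 ≤ borelHeight (t : (quasiSplit F E c 3).Adelic) →
      (((diagUnit t.2 0)⁻¹ * diagUnit t.2 1 : (AdeleRing (𝓞 E) E)ˣ) : AdeleRing (𝓞 E) E) ∈ R₁ ∧
      (((diagUnit t.2 0)⁻¹ * diagUnit t.2 2 : (AdeleRing (𝓞 E) E)ˣ) : AdeleRing (𝓞 E) E) ∈ R₂ := by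
  -- constants: `n = [E:ℚ] > 0`, `H₁ = H(1)`, `r = H₁^{1/n}`
  set n : ℝ := (Module.finrank ℚ E : ℝ) with hn
  have hn0 : 0 < n := by
    rw [hn]
    exact_mod_cast Module.finrank_pos
  set H₁ : ℝ := ((borelHeight (1 : (quasiSplit F E c 3).Adelic) : ℝ≥0) : ℝ) with hH₁
  set r : ℝ := H₁ ^ (1 / n) with hr
  -- the compact pieces
  set Ray : Set (AdeleRing (𝓞 E) E) := realAdele E '' Icc 0 r with hRay
  have hRayc : IsCompact Ray := isCompact_Icc.image (continuous_realAdele E)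
  set V₁ : Set (AdeleRing (𝓞 E) E) := (fun p : (AdeleRing (𝓞 E) E)ˣ × (AdeleRing (𝓞 E) E)ˣ =>
    (((p.1⁻¹ * p.2 : (AdeleRing (𝓞 E) E)ˣ)) : AdeleRing (𝓞 E) E)) '' (W ×ˢ W) with hV₁
  have hV₁c : IsCompact V₁ :=
    (hW.prod hW).image (Units.continuous_val.comp (continuous_fst.inv.mul continuous_snd))
  set V₂ : Set (AdeleRing (𝓞 E) E) := (fun u : (AdeleRing (𝓞 E) E)ˣ =>
    ((u⁻¹ : (AdeleRing (𝓞 E) E)ˣ) : AdeleRing (𝓞 E) E) *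
      conjAdele F E c ((u⁻¹ : (AdeleRing (𝓞 E) E)ˣ) : AdeleRing (𝓞 E) E)) '' W with hV₂
  have hV₂c : IsCompact V₂ :=
    hW.image ((Units.continuous_val.comp continuous_inv).mul
      ((continuous_conjAdele F E c).comp (Units.continuous_val.comp continuous_inv)))
  refine ⟨(fun p : AdeleRing (𝓞 E) E × AdeleRing (𝓞 E) E => p.1 * p.2) '' (Ray ×ˢ V₁),
    (fun p : AdeleRing (𝓞 E) E × AdeleRing (𝓞 E) E => p.1 * p.1 * p.2) '' (Ray ×ˢ V₂),
    (hRayc.prod hV₁c).image (continuous_fst.mul continuous_snd),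
    (hRayc.prod hV₂c).image ((continuous_fst.mul continuous_fst).mul continuous_snd),
    fun t ht hH => ?_⟩
  obtain ⟨w, hwW, s, hd0, hd1, hnorm, hHt⟩ := hexp t ht
  -- `e^{-s} ∈ [0, r]`
  have hray : realAdele E (Real.exp (-s)) ∈ Ray := by
    refine ⟨Real.exp (-s), ⟨(Real.exp_pos _).le, ?_⟩, rfl⟩
    refine exp_neg_le_of_one_le_height hn0 ?_
    have h1 : (1 : ℝ) ≤ ((borelHeight (t : (quasiSplit F E c 3).Adelic) : ℝ≥0) : ℝ) := by exact_mod_cast hH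
    rw [hHt, hnorm, NNReal.coe_mul, coe_expUnitNNReal] at h1
    exact h1
  -- `d₀⁻¹ = z(e^{-s}) · w⁻¹`
  have hd0inv : (((diagUnit t.2 0)⁻¹ : (AdeleRing (𝓞 E) E)ˣ) : AdeleRing (𝓞 E) E) =
      realAdele E (Real.exp (-s)) * ((w⁻¹ : (AdeleRing (𝓞 E) E)ˣ) : AdeleRing (𝓞 E) E) := by
    rw [hd0, mul_inv_rev, Units.val_mul, coe_inv_posRealIdele_expUnitNNReal]
  refine ⟨?_, ?_⟩
  · -- `d₀⁻¹ d₁ = z(e^{-s}) · (w⁻¹ d₁)`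
    refine ⟨(realAdele E (Real.exp (-s)), (((w⁻¹ * diagUnit t.2 1 : (AdeleRing (𝓞 E) E)ˣ)) : AdeleRing (𝓞 E) E)),
      Set.mk_mem_prod hray ⟨(w, diagUnit t.2 1), Set.mk_mem_prod hwW hd1, rfl⟩, ?_⟩
    change realAdele E (Real.exp (-s)) * (((w⁻¹ * diagUnit t.2 1 : (AdeleRing (𝓞 E) E)ˣ)) : AdeleRing (𝓞 E) E) = _
    rw [Units.val_mul, Units.val_mul, hd0inv, mul_assoc]
  · -- `d₀⁻¹ d₂ = z(e^{-s})² · (w⁻¹ c(w⁻¹))`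
    refine ⟨(realAdele E (Real.exp (-s)), ((w⁻¹ : (AdeleRing (𝓞 E) E)ˣ) : AdeleRing (𝓞 E) E) *
        conjAdele F E c ((w⁻¹ : (AdeleRing (𝓞 E) E)ˣ) : AdeleRing (𝓞 E) E)),
      Set.mk_mem_prod hray ⟨w, hwW, rfl⟩, ?_⟩
    change realAdele E (Real.exp (-s)) * realAdele E (Real.exp (-s)) *
        (((w⁻¹ : (AdeleRing (𝓞 E) E)ˣ) : AdeleRing (𝓞 E) E) *
          conjAdele F E c ((w⁻¹ : (AdeleRing (𝓞 E) E)ˣ) : AdeleRing (𝓞 E) E)) = _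
    rw [Units.val_mul, coe_diagUnit_two_eq_conjAdele_inv (hSTt t ht), hd0inv, map_mul]
    -- `c(z(e^{-s})) = z(e^{-s})`
    have hfix : conjAdele F E c (realAdele E (Real.exp (-s))) = realAdele E (Real.exp (-s)) := by
      rw [← coe_inv_posRealIdele_expUnitNNReal, ← map_inv]
      exact conjAdele_coe_posRealIdele _
    rw [hfix]
    ring

/-! ## §4 The archimedean balance -/

/-- **THE ARCHIMEDEAN BALANCE.** Under the same polar export there is `κ` with
`‖(d₀⁻¹ d₁)_w‖ ≤ κ · H(t)^{-1/[E:ℚ]}` for every `t ∈ S_T` and every infinite place `w` of `E`: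
`(d₀⁻¹ d₁)_w = e^{-s} · (w⁻¹ d₁)_w` with `‖z(r)_w‖ = r` (★ `nnnorm_posRealIdele_fst_apply`), `w⁻¹ d₁` in the
compact `W⁻¹ W`, and `e^{-s} = H(t)^{-1/[E:ℚ]} · H(1)^{1/[E:ℚ]}` (§2) — the BALANCE clause of brick H9a
(one power of the ray for the oscillation and the ray integral). [cite: Rogawski1990, §2.2 (p. 13)] -/
theorem exists_balance_of_export {S_T : Set (borelAdelic F E c 3)}
    {W : Set (AdeleRing (𝓞 E) E)ˣ} (hW : IsCompact W)
    (hexp : ∀ t ∈ S_T, ∃ w ∈ W, ∃ s : ℝ,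
      diagUnit t.2 0 = w * posRealIdele E (expUnitNNReal s) ∧ diagUnit t.2 1 ∈ W ∧
      IdeleClassGroup.ideleNorm E (diagUnit t.2 0) = ((expUnitNNReal (Module.finrank ℚ E * s) : ℝ≥0ˣ) : ℝ≥0) ∧
      borelHeight (t : (quasiSplit F E c 3).Adelic) =
        IdeleClassGroup.ideleNorm E (diagUnit t.2 0) * borelHeight (1 : (quasiSplit F E c 3).Adelic)) :
    ∃ κ : ℝ, ∀ t ∈ S_T, ∀ w : InfinitePlace E,
      ‖((((diagUnit t.2 0)⁻¹ * diagUnit t.2 1 : (AdeleRing (𝓞 E) E)ˣ) : AdeleRing (𝓞 E) E)).1 w‖ ≤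
        κ * ((borelHeight (t : (quasiSplit F E c 3).Adelic) : ℝ) ^ (-(1 / (Module.finrank ℚ E : ℝ)))) := by
  classical
  set n : ℝ := (Module.finrank ℚ E : ℝ) with hn
  have hn0 : n ≠ 0 := by
    rw [hn]
    exact_mod_cast Module.finrank_pos.ne'
  set H₁ : ℝ := ((borelHeight (1 : (quasiSplit F E c 3).Adelic) : ℝ≥0) : ℝ) with hH₁
  have hH₁0 : 0 < H₁ := by
    rw [hH₁, NNReal.coe_pos, borelHeight_def]
    exact inv_pos.2 (vecHeight_lastRow_pos _)
  -- a uniform bound `κ₀` for the archimedean components of `w⁻¹ d₁ ∈ W⁻¹ W`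
  set V₁ : Set (AdeleRing (𝓞 E) E) := (fun p : (AdeleRing (𝓞 E) E)ˣ × (AdeleRing (𝓞 E) E)ˣ =>
    (((p.1⁻¹ * p.2 : (AdeleRing (𝓞 E) E)ˣ)) : AdeleRing (𝓞 E) E)) '' (W ×ˢ W) with hV₁
  have hV₁c : IsCompact V₁ :=
    (hW.prod hW).image (Units.continuous_val.comp (continuous_fst.inv.mul continuous_snd))
  have hbd : ∀ w : InfinitePlace E, ∃ C : ℝ, ∀ x ∈ V₁, ‖x.1 w‖ ≤ C := fun w =>
    hV₁c.exists_bound_of_continuousOn ((continuous_apply w).comp continuous_fst).continuousOn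
  choose C hC using hbd
  set κ₀ : ℝ := ∑ w : InfinitePlace E, max (C w) 0 with hκ₀
  have hκ₀w : ∀ w : InfinitePlace E, ∀ x ∈ V₁, ‖x.1 w‖ ≤ κ₀ := fun w x hx =>
    ((hC w x hx).trans (le_max_left _ _)).trans
      (Finset.single_le_sum (f := fun w => max (C w) 0) (fun w _ => le_max_right _ _) (Finset.mem_univ w))
  have hκ₀0 : 0 ≤ κ₀ := Finset.sum_nonneg fun w _ => le_max_right _ _
  refine ⟨κ₀ * H₁ ^ (1 / n), fun t ht w => ?_⟩
  obtain ⟨u, huW, s, hd0, hd1, hnorm, hHt⟩ := hexp t ht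
  -- `d₀⁻¹ d₁ = z(e^{-s}) · (u⁻¹ d₁)`
  have hval : (((diagUnit t.2 0)⁻¹ * diagUnit t.2 1 : (AdeleRing (𝓞 E) E)ˣ) : AdeleRing (𝓞 E) E) =
      (((posRealIdele E (expUnitNNReal s))⁻¹ : (AdeleRing (𝓞 E) E)ˣ) : AdeleRing (𝓞 E) E) *
        (((u⁻¹ * diagUnit t.2 1 : (AdeleRing (𝓞 E) E)ˣ)) : AdeleRing (𝓞 E) E) := by
    rw [hd0, mul_inv_rev, ← Units.val_mul, mul_assoc]
  have hmem : (((u⁻¹ * diagUnit t.2 1 : (AdeleRing (𝓞 E) E)ˣ)) : AdeleRing (𝓞 E) E) ∈ V₁ :=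
    ⟨(u, diagUnit t.2 1), Set.mk_mem_prod huW hd1, rfl⟩
  -- `‖z(e^{-s})_w‖ = e^{-s}`
  have hzr : ‖((((posRealIdele E (expUnitNNReal s))⁻¹ : (AdeleRing (𝓞 E) E)ˣ) : AdeleRing (𝓞 E) E)).1 w‖ =
      Real.exp (-s) := by
    have h : (expUnitNNReal s)⁻¹ = expUnitNNReal (-s) := Units.ext (Subtype.ext rfl)
    rw [← map_inv, h, ← coe_nnnorm, nnnorm_posRealIdele_fst_apply]
    exact coe_expUnitNNReal (-s)
  -- `e^{-s} = H(t)^{-1/n} · H₁^{1/n}`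
  have hexp_eq : Real.exp (-s) =
      ((borelHeight (t : (quasiSplit F E c 3).Adelic) : ℝ) ^ (-(1 / n))) * H₁ ^ (1 / n) := by
    have hH : ((borelHeight (t : (quasiSplit F E c 3).Adelic) : ℝ≥0) : ℝ) = Real.exp (n * s) * H₁ := by
      rw [hHt, hnorm, NNReal.coe_mul, coe_expUnitNNReal]
    rw [hH]
    exact exp_neg_eq_rpow_height hn0 hH₁0
  calc ‖((((diagUnit t.2 0)⁻¹ * diagUnit t.2 1 : (AdeleRing (𝓞 E) E)ˣ) : AdeleRing (𝓞 E) E)).1 w‖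
      = Real.exp (-s) * ‖((((u⁻¹ * diagUnit t.2 1 : (AdeleRing (𝓞 E) E)ˣ)) : AdeleRing (𝓞 E) E)).1 w‖ := by
        have hsplit : ∀ x y : AdeleRing (𝓞 E) E, (x * y).1 w = x.1 w * y.1 w := fun _ _ => rfl
        rw [hval, hsplit, norm_mul, hzr]
    _ ≤ Real.exp (-s) * κ₀ := mul_le_mul_of_nonneg_left (hκ₀w w _ hmem) (Real.exp_pos _).le
    _ = κ₀ * H₁ ^ (1 / n) * ((borelHeight (t : (quasiSplit F E c 3).Adelic) : ℝ) ^ (-(1 / n))) := by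
        rw [hexp_eq]
        ring

/-! ## §5 Both clauses together -/

/-- **LETTERS ∧ BALANCE from the polar export** (the two window clauses of brick H9a's
`exists_torusSiegelSet`, derived from its EXPORT clause alone). [cite: Rogawski1990, §2.2 (p. 13)] -/
theorem exists_rootWindows_and_balance_of_export {S_T : Set (borelAdelic F E c 3)}
    {W : Set (AdeleRing (𝓞 E) E)ˣ} (hW : IsCompact W) (hSTt : ∀ t ∈ S_T, torusPart t = t)
    (hexp : ∀ t ∈ S_T, ∃ w ∈ W, ∃ s : ℝ,
      diagUnit t.2 0 = w * posRealIdele E (expUnitNNReal s) ∧ diagUnit t.2 1 ∈ W ∧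
      IdeleClassGroup.ideleNorm E (diagUnit t.2 0) = ((expUnitNNReal (Module.finrank ℚ E * s) : ℝ≥0ˣ) : ℝ≥0) ∧
      borelHeight (t : (quasiSplit F E c 3).Adelic) =
        IdeleClassGroup.ideleNorm E (diagUnit t.2 0) * borelHeight (1 : (quasiSplit F E c 3).Adelic)) :
    (∃ R₁ R₂ : Set (AdeleRing (𝓞 E) E), IsCompact R₁ ∧ IsCompact R₂ ∧ ∀ t ∈ S_T,
        1 ≤ borelHeight (t : (quasiSplit F E c 3).Adelic) →
        (((diagUnit t.2 0)⁻¹ * diagUnit t.2 1 : (AdeleRing (𝓞 E) E)ˣ) : AdeleRing (𝓞 E) E) ∈ R₁ ∧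
        (((diagUnit t.2 0)⁻¹ * diagUnit t.2 2 : (AdeleRing (𝓞 E) E)ˣ) : AdeleRing (𝓞 E) E) ∈ R₂) ∧
    (∃ κ : ℝ, ∀ t ∈ S_T, ∀ w : InfinitePlace E,
        ‖((((diagUnit t.2 0)⁻¹ * diagUnit t.2 1 : (AdeleRing (𝓞 E) E)ˣ) : AdeleRing (𝓞 E) E)).1 w‖ ≤
          κ * ((borelHeight (t : (quasiSplit F E c 3).Adelic) : ℝ) ^ (-(1 / (Module.finrank ℚ E : ℝ))))) :=
  ⟨exists_rootWindows_of_export hW hSTt hexp, exists_balance_of_export hW hexp⟩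

end UnitaryGroup

end Literature.NumberTheory.Automorphic
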